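import Summits.BirchSwinnertonDyer.BirchSwinnertonDyer.Theorems.ByReductionTypeAtTwoTowerLayerCert
import Summits.BirchSwinnertonDyer.BirchSwinnertonDyer.Theorems.ByReductionTypeAtTwoTowerLayerKatoHalf
import Summits.BirchSwinnertonDyer.BirchSwinnertonDyer.Theorems.ByReductionTypeAtTwoGVIInstance32505h
import Summits.BirchSwinnertonDyer.BirchSwinnertonDyer.Theorems.Rank1ResidualIntModelReduction
import Summits.BirchSwinnertonDyer.Rank1Residual.X5.TwoAdicInstancesToolkit
import Summits.BirchSwinnertonDyer.Rank1Residual.X5.TwoAdicImageCertificates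
import Summits.BirchSwinnertonDyer.Rank1Residual.Additive.BudgetFromRationalClasses
import HarnessLib

/-!
# TOWER road, CLASS TEMPLATE at the X5 class **32505h** (`E = 32505h1`, `N = 3·5·11·197`, `E[2]`
# irreducible, `λ_an = 4`): every kernel-side datum of the `Ш`-currency door decided; what remains is
# displayed — PRINT ×8 + the ENGINE certificates `d₀ ≥ 2`, `d₃ ≤ 4` (layer `ℚ(ζ₃₂)⁺`), `MissingLowerBoundAt`,
# Néron integrality, `r_an = 0` (route ByReductionTypeAtTwo, item stmt-BirchSwinnertonDyer-19271;
# seat bsd-2adic-tower-1 GEN 2, part 10)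

HONEST FRAMING (cell `bsd-2adic`, run/shared/lean/pub/bsd-2adic/, HUMAN RULINGS D-0036/D-0054/D-0074): a
TEMPLATE, not a close. Nothing is booked by this file: the class theorem below keeps as HYPOTHESES the
eight PRINT binders (named facts) and the five per-curve certificates that only the cell's ENGINES /
tables can supply (tower-eng's layer Selmer dimensions `d_j = dim_𝔽₂ Sel₂(E/ℚ_j)`; ord-3's descent
inequality; `hper₀`; `r_an = 0`); a close needs those certificates two-engine (R251), the OFFER and the
referee's PASS. What the file DOES prove (kernel): odd torsion (`E[2]` irreducible: the `2`-division cubic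
has no root mod `7`), the odd bad primes `P = {3, 5, 11, 197}` with `Δ_min = −3²·5⁹·11²·197`, multiplicative
reduction at each (`ℓ ∣ Δ`, `ℓ ∤ c₄ = 73048969`), the local constants `C₃ = C₁₁ = 2` (even `ord_ℓ Δ`),
`C₅ = C₁₉₇ = 1` (odd), the decomposition exponents `e_ℓ = 0` (all four `ℓ ≡ ±3 (mod 8)`: one prime above
`ℓ` in every layer), and the arithmetic at `(j, j') = (0, 3)`, `a = 2`:
`2^d · 4 · (2·1·2·1) < 2^{8 − 1 + 2} = 512 ⟺ d ≤ 4`.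
READING (not asserted): `λ_an(32505h1) = 4` (both cell engines), so the `2`-adic IMC predicts
`d₃ ≤ dim X/(2,T⁸)X ≤ 4` — the certificate `hd : d ≤ 4` is expected to be met EXACTLY at the margin; the
layer `ℚ(ζ₁₆)⁺` cannot close this class (`2^{d₂}·16 < 32` is impossible).

References: [CremonaAlgorithms1997] Table 1 (32505h1); [GreenbergLNM1716] §3, Thm. 4.1; [Kato2004Asterisque]
Thm. 17.4; [SilvermanAEC2009] VII.1, VII.5.1.
-/

set_option autoImplicit false

noncomputable section

open scoped Classical MatrixGroups ModularForm

open NumberField IsDedekindDomain CongruenceSubgroup WeierstrassCurve Literature.NumberTheory.EllipticCurves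
  Literature.NumberTheory.EllipticCurves.ModularForms Literature.NumberTheory.EllipticCurves.Rank1Residual
  Literature.NumberTheory.EllipticCurves.Rank1Residual.Typed
  Literature.NumberTheory.EllipticCurves.Greenberg1999
  Summit.BirchSwinnertonDyer.Rank1Residual.X1.MuLambda
  Summit.BirchSwinnertonDyer.Rank1Residual.X1.MuPart
  Summit.BirchSwinnertonDyer.Rank1Residual.X1.ParitySqueeze
  Summit.BirchSwinnertonDyer.BirchSwinnertonDyer.Theorems.Rank1ResidualX1Defs
  Summit.BirchSwinnertonDyer.Rank1Residual.X5 Summit.BirchSwinnertonDyer.Rank1Residual.X5.O1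
  Summit.BirchSwinnertonDyer.Rank1Residual.X5.TowerGap
  Summit.BirchSwinnertonDyer.Rank1Residual
  Summit.BirchSwinnertonDyer.BirchSwinnertonDyer.Theorems.GVISeed

namespace Summit.BirchSwinnertonDyer.BirchSwinnertonDyer.Theorems.KatoHalfPinch.Tower32505h

/-! ## §1 The kernel-decided data of `32505h1` for the TOWER door -/

/-- **`2 ∤ #E(ℚ)_tors`** for `32505h1`: `E[2]` is irreducible (the monic `2`-division cubic
`X³ + X² − 24349656X − 46255521456` has no root modulo `7`). [cite: SilvermanAEC2009, III.2.3 (b)] -/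
theorem not_two_dvd_torsionOrder : ¬ 2 ∣ c32505h1.torsionOrder := by
  haveI : Fact (Nat.Prime 2) := ⟨Nat.prime_two⟩
  refine Additive.not_dvd_torsionOrder_of_irr' 2 c32505h1 ?_
  exact irr_two_of_forall_cubic_ne c32505h1 c32505h1_b.1 c32505h1_b.2.1 c32505h1_b.2.2 (ℓ := 7)
    (by decide)

/-- `Δ_min(32505h1) = −419009765625 = −3²·5⁹·11²·197`. [cite: CremonaAlgorithms1997, Table 1] -/
theorem minimalDiscriminantInt_eq : c32505h1.minimalDiscriminantInt = -419009765625 := by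
  rw [minimalDiscriminantInt_baseChange_int, M32505h1_Δ]

/-- **The odd bad primes**: every odd prime dividing `Δ_min` is in `P = {3, 5, 11, 197}`
(`|Δ_min| = 3²·5⁹·11²·197`). [cite: CremonaAlgorithms1997, Table 1] -/
theorem mem_P_of_dvd : ∀ ℓ : ℕ, ℓ.Prime → ℓ ≠ 2 → (ℓ : ℤ) ∣ c32505h1.minimalDiscriminantInt →
    ℓ ∈ ({3, 5, 11, 197} : Finset ℕ) := by
  intro ℓ hℓ _ hdvd
  rw [minimalDiscriminantInt_eq,
    show (-419009765625 : ℤ) = -((3 ^ 2 * 5 ^ 9 * 11 ^ 2 * 197 : ℕ) : ℤ) by norm_num,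
    Int.dvd_neg, Int.natCast_dvd_natCast] at hdvd
  simp only [Finset.mem_insert, Finset.mem_singleton]
  have hℓ' := hℓ.prime
  rcases hℓ'.dvd_or_dvd hdvd with h | h
  · rcases hℓ'.dvd_or_dvd h with h | h
    · rcases hℓ'.dvd_or_dvd h with h | h
      · exact Or.inl ((Nat.prime_dvd_prime_iff_eq hℓ Nat.prime_three).mp (hℓ.dvd_of_dvd_pow h))
      · exact Or.inr (Or.inl ((Nat.prime_dvd_prime_iff_eq hℓ Nat.prime_five).mp (hℓ.dvd_of_dvd_pow h)))
    · exact Or.inr (Or.inr (Or.inl ((Nat.prime_dvd_prime_iff_eq hℓ (by norm_num)).mp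
        (hℓ.dvd_of_dvd_pow h))))
  · exact Or.inr (Or.inr (Or.inr ((Nat.prime_dvd_prime_iff_eq hℓ (by norm_num)).mp h)))

/-- `c₄(32505h1) = 73048969` (`= 7²·1490795 + …`; coprime to `Δ`). [cite: CremonaAlgorithms1997, Table 1] -/
theorem M32505h1_c₄ : M32505h1.c₄ = 73048969 := by decide

/-- **Multiplicative reduction at `3, 5, 11, 197`** (`ℓ ∣ Δ`, `ℓ ∤ c₄`; `N = 32505` is squarefree).
[cite: SilvermanAEC2009, VII.5 Prop. 5.1(b)] -/
theorem hasMultiplicativeReductionAtPrime (ℓ : ℕ) [Fact ℓ.Prime] (h : ℓ = 3 ∨ ℓ = 5 ∨ ℓ = 11 ∨ ℓ = 197) :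
    c32505h1.HasMultiplicativeReductionAtPrime ℓ := by
  refine Summit.BirchSwinnertonDyer.BirchSwinnertonDyer.Rank1Residual.IntModel.hasMultiplicativeReductionAtPrime_of_intModel
    (integralModelInt_baseChange_int M32505h1) ℓ ?_ ?_
  · rw [M32505h1_Δ]; rcases h with rfl | rfl | rfl | rfl <;> norm_num
  · rw [M32505h1_c₄]; rcases h with rfl | rfl | rfl | rfl <;> norm_num

/-! ## §2 The class theorem (TEMPLATE: engine certificates displayed as hypotheses) -/

/-- **`BSD(32505h1, 2)` from the TOWER road at the layer `ℚ(ζ₃₂)⁺`, `Ш`-currency** — TEMPLATE. PRINT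
(named facts, displayed): `hmod`, `hGZK`, `h17` (Kato 17.4 (1)(2)@2), `hEC` (Greenberg Thm. 4.1@2),
`h33g`/`hM`/`hA` (Greenberg L.3.3@2 readings), `hS34` (L.3.4@2 structure). CERTIFICATES displayed
(engines / tables): `hper₀` (Néron integrality), `hr` (`r_an = 0`, Cremona), `hlow` (`d₀ ≥ 2`: two
independent classes in `Sel_{2^∞}(E/ℚ)[2]` — the `2`-descent `dim Sel₂(E/ℚ) = 2`), `hd`+`hup`
(`#Sel_{2^∞}(E/ℚ(ζ₃₂)⁺)[2] ≤ 2^d` with `d ≤ 4`: the layer-`3` descent), `hsha` (`ord₂ #Ш_an ≤ ord₂ #Ш`,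
ord-3's certificate `Ш[4] ≅ (ℤ/4)²`). Kernel-decided: everything else (§1 + the arithmetic
`2^d·4·4 < 512`). [cite: GreenbergLNM1716, Thm. 4.1 (p. 102), §3 Lemmas 3.3–3.5, Prop. 2.5]
[cite: Kato2004Asterisque, Thm. 17.4 (1)(2) (p. 273)] [cite: Miller2011LMS, Def. 1.1] [cite: CremonaAlgorithms1997, Table 1] -/
theorem bsdp_two_32505h1_of_layerThree
    (hmod : nonempty_modularParametrizationData) (hGZK : rank_eq_analyticRank_of_analyticRank_le_one)
    (h17 : ∀ [NeZero (c32505h1.conductorNorm ℤ)] (f : CuspForm (Gamma0 (c32505h1.conductorNorm ℤ)) 2),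
      kato_divisibility_allPrimes c32505h1 2 (f := f))
    (hEC : TwoAdicEulerCharRankZero c32505h1 0)
    (h33g : lemma33_localTowerKerPrimary_eq_bot_of_good.{0})
    (hM : lemma33_localTowerKerPrimary_cyclic_of_multiplicative.{0})
    (hA : lemma33_natCard_localTowerKerPrimary_le_four_of_additive.{0})
    (hS34 : lemma34_localTowerKerPrimary_cyclicExtension_rat)
    (hper₀ : ∀ [NeZero (c32505h1.conductorNorm ℤ)] (f : CuspForm (Gamma0 (c32505h1.conductorNorm ℤ)) 2),
      IsNewformOf c32505h1 f → ∀ ϖ : ℚ, (ϖ : ℝ) * c32505h1.realPeriodRat = plusPeriod f →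
        0 ≤ padicValRat 2 ϖ)
    (hr : c32505h1.analyticRank = 0)
    (hlow : ∀ κ : ZpExtension ℚ 2, κ.IsCyclotomic →
      2 ^ 2 ≤ Nat.card {z : c32505h1.selmerLayer κ 0 // 2 • z = 0})
    {d : ℕ} (hd : d ≤ 4)
    (hup : ∀ κ : ZpExtension ℚ 2, κ.IsCyclotomic →
      Nat.card {z : c32505h1.selmerLayer κ 3 // 2 • z = 0} ≤ 2 ^ d)
    (hsha : MissingLowerBoundAt c32505h1 2) : BSDp c32505h1 2 := by
  refine bsdp_two_of_layerSelmer_cert_of_missingLowerBoundAt c32505h1 hmod hGZK h17 hEC h33g hM hA hS34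
    hper₀ goodOrd_two_32505h1 hr not_two_dvd_torsionOrder (j := 0) (j' := 3) (by norm_num)
    {3, 5, 11, 197} ?_ mem_P_of_dvd
    (fun ℓ ↦ if ℓ = 3 ∨ ℓ = 11 then 2 else 1) (fun _ ↦ 0) (fun ℓ ↦ if ℓ = 5 then 9 else 1) ?_
    (fun ℓ _ hℓ ↦ ?_) hlow hup ?_ hsha
  · -- `P` consists of odd primes
    intro ℓ hℓ
    simp only [Finset.mem_insert, Finset.mem_singleton] at hℓ
    rcases hℓ with rfl | rfl | rfl | rfl <;> exact ⟨by norm_num, by norm_num⟩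
  · -- `e_ℓ = 0`: `16 ∤ ℓ² − 1` (all four `ℓ ≡ ±3 (mod 8)`)
    intro ℓ hℓ
    simp only [Finset.mem_insert, Finset.mem_singleton] at hℓ
    rcases hℓ with rfl | rfl | rfl | rfl <;> norm_num
  · -- the local constants
    simp only [Finset.mem_insert, Finset.mem_singleton] at hℓ
    rcases hℓ with rfl | rfl | rfl | rfl
    · exact Or.inr (Or.inl ⟨hasMultiplicativeReductionAtPrime 3 (Or.inl rfl), by norm_num⟩)
    · refine Or.inr (Or.inr (Or.inl ⟨hasMultiplicativeReductionAtPrime 5 (Or.inr (Or.inl rfl)), ?_, ?_,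
        by norm_num, by norm_num⟩))
      · rw [minimalDiscriminantInt_eq]; norm_num
      · rw [minimalDiscriminantInt_eq]; norm_num
    · exact Or.inr (Or.inl ⟨hasMultiplicativeReductionAtPrime 11 (Or.inr (Or.inr (Or.inl rfl))),
        by norm_num⟩)
    · refine Or.inr (Or.inr (Or.inl ⟨hasMultiplicativeReductionAtPrime 197 (Or.inr (Or.inr (Or.inr rfl))),
        ?_, ?_, by norm_num, by norm_num⟩))
      · rw [minimalDiscriminantInt_eq]; norm_num
      · rw [minimalDiscriminantInt_eq]; norm_num
  · -- the arithmetic `2^d · 4 · 4 < 2^9`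
    calc 2 ^ d * 4 * ∏ ℓ ∈ ({3, 5, 11, 197} : Finset ℕ),
          (if ℓ = 3 ∨ ℓ = 11 then 2 else 1) ^ 2 ^ min 3 ((fun _ : ℕ ↦ 0) ℓ)
        ≤ 2 ^ 4 * 4 * ∏ ℓ ∈ ({3, 5, 11, 197} : Finset ℕ),
          (if ℓ = 3 ∨ ℓ = 11 then 2 else 1) ^ 2 ^ min 3 ((fun _ : ℕ ↦ 0) ℓ) :=
          Nat.mul_le_mul_right _ (Nat.mul_le_mul_right _ (Nat.pow_le_pow_right (by norm_num) hd))
      _ < 2 ^ (2 ^ 3 - 2 ^ 0 + 2) := by decide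

/-- **The `2`-adic main conjecture for `32505h1`** (hence the item `OrdKatoHalfAtTwo` at this class)
from the same displayed PRINT + certificates — TEMPLATE. [cite: Kato2004Asterisque, Thm. 17.4 (1)(2) (p. 273)]
[cite: GreenbergLNM1716, Thm. 4.1 (p. 102), §3 Lemmas 3.3–3.5, Prop. 2.5] -/
theorem mazurMainConjecture_two_32505h1_of_layerThree
    (hmod : nonempty_modularParametrizationData) (hGZK : rank_eq_analyticRank_of_analyticRank_le_one)
    (h17 : ∀ [NeZero (c32505h1.conductorNorm ℤ)] (f : CuspForm (Gamma0 (c32505h1.conductorNorm ℤ)) 2),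
      kato_divisibility_allPrimes c32505h1 2 (f := f))
    (hEC : TwoAdicEulerCharRankZero c32505h1 0)
    (h33g : lemma33_localTowerKerPrimary_eq_bot_of_good.{0})
    (hM : lemma33_localTowerKerPrimary_cyclic_of_multiplicative.{0})
    (hA : lemma33_natCard_localTowerKerPrimary_le_four_of_additive.{0})
    (hS34 : lemma34_localTowerKerPrimary_cyclicExtension_rat)
    (hper₀ : ∀ [NeZero (c32505h1.conductorNorm ℤ)] (f : CuspForm (Gamma0 (c32505h1.conductorNorm ℤ)) 2),
      IsNewformOf c32505h1 f → ∀ ϖ : ℚ, (ϖ : ℝ) * c32505h1.realPeriodRat = plusPeriod f →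
        0 ≤ padicValRat 2 ϖ)
    (hr : c32505h1.analyticRank = 0)
    (hlow : ∀ κ : ZpExtension ℚ 2, κ.IsCyclotomic →
      2 ^ 2 ≤ Nat.card {z : c32505h1.selmerLayer κ 0 // 2 • z = 0})
    {d : ℕ} (hd : d ≤ 4)
    (hup : ∀ κ : ZpExtension ℚ 2, κ.IsCyclotomic →
      Nat.card {z : c32505h1.selmerLayer κ 3 // 2 • z = 0} ≤ 2 ^ d)
    (hsha : MissingLowerBoundAt c32505h1 2) : MazurMainConjecture c32505h1 2 := by
  refine mazurMainConjecture_two_of_layerSelmer_cert_of_missingLowerBoundAt c32505h1 hmod hGZK h17 hEC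
    h33g hM hA hS34 hper₀ goodOrd_two_32505h1 hr not_two_dvd_torsionOrder (j := 0) (j' := 3)
    (by norm_num) {3, 5, 11, 197} ?_ mem_P_of_dvd
    (fun ℓ ↦ if ℓ = 3 ∨ ℓ = 11 then 2 else 1) (fun _ ↦ 0) (fun ℓ ↦ if ℓ = 5 then 9 else 1) ?_
    (fun ℓ _ hℓ ↦ ?_) hlow hup ?_ hsha
  · intro ℓ hℓ
    simp only [Finset.mem_insert, Finset.mem_singleton] at hℓ
    rcases hℓ with rfl | rfl | rfl | rfl <;> exact ⟨by norm_num, by norm_num⟩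
  · intro ℓ hℓ
    simp only [Finset.mem_insert, Finset.mem_singleton] at hℓ
    rcases hℓ with rfl | rfl | rfl | rfl <;> norm_num
  · simp only [Finset.mem_insert, Finset.mem_singleton] at hℓ
    rcases hℓ with rfl | rfl | rfl | rfl
    · exact Or.inr (Or.inl ⟨hasMultiplicativeReductionAtPrime 3 (Or.inl rfl), by norm_num⟩)
    · refine Or.inr (Or.inr (Or.inl ⟨hasMultiplicativeReductionAtPrime 5 (Or.inr (Or.inl rfl)), ?_, ?_,
        by norm_num, by norm_num⟩))
      · rw [minimalDiscriminantInt_eq]; norm_num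
      · rw [minimalDiscriminantInt_eq]; norm_num
    · exact Or.inr (Or.inl ⟨hasMultiplicativeReductionAtPrime 11 (Or.inr (Or.inr (Or.inl rfl))),
        by norm_num⟩)
    · refine Or.inr (Or.inr (Or.inl ⟨hasMultiplicativeReductionAtPrime 197 (Or.inr (Or.inr (Or.inr rfl))),
        ?_, ?_, by norm_num, by norm_num⟩))
      · rw [minimalDiscriminantInt_eq]; norm_num
      · rw [minimalDiscriminantInt_eq]; norm_num
  · calc 2 ^ d * 4 * ∏ ℓ ∈ ({3, 5, 11, 197} : Finset ℕ),
          (if ℓ = 3 ∨ ℓ = 11 then 2 else 1) ^ 2 ^ min 3 ((fun _ : ℕ ↦ 0) ℓ)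
        ≤ 2 ^ 4 * 4 * ∏ ℓ ∈ ({3, 5, 11, 197} : Finset ℕ),
          (if ℓ = 3 ∨ ℓ = 11 then 2 else 1) ^ 2 ^ min 3 ((fun _ : ℕ ↦ 0) ℓ) :=
          Nat.mul_le_mul_right _ (Nat.mul_le_mul_right _ (Nat.pow_le_pow_right (by norm_num) hd))
      _ < 2 ^ (2 ^ 3 - 2 ^ 0 + 2) := by decide

/-! ## §3 ADDENDUM (same seat): the item AT the class from the gap ALONE (part 12) -/

/-- **The item `OrdKatoHalfAtTwo` AT `32505h1` (`char_Λ X ∣ ϖ·L₂` integrally) from the GAP certificate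
alone** — TEMPLATE: PRINT {`h17` (Kato 17.4 (1)(2)@2), `h33g`/`hM`/`hA` (Greenberg L.3.3@2 readings),
`hS34` (L.3.4@2 structure)} + certificates {`hper₀`, `hlow` (`d₀ ≥ 2`), `hd : d ≤ 4` + `hup` (layer
`ℚ(ζ₃₂)⁺`)}; NO `r_an`, NO `MissingLowerBoundAt`, NO `λ_an`/`μ_an`/Prop. 4.14. Kernel-decided data as
in §1–§2. [cite: Kato2004Asterisque, Thm. 17.4 (1)(2) (p. 273)] [cite: GreenbergLNM1716, §3 Lemmas 3.3–3.5, Prop. 2.5]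
[cite: CremonaAlgorithms1997, Table 1] -/
theorem katoHalfAt_two_32505h1_of_layerThree
    (h17 : ∀ [NeZero (c32505h1.conductorNorm ℤ)] (f : CuspForm (Gamma0 (c32505h1.conductorNorm ℤ)) 2),
      kato_divisibility_allPrimes c32505h1 2 (f := f))
    (h33g : lemma33_localTowerKerPrimary_eq_bot_of_good.{0})
    (hM : lemma33_localTowerKerPrimary_cyclic_of_multiplicative.{0})
    (hA : lemma33_natCard_localTowerKerPrimary_le_four_of_additive.{0})
    (hS34 : lemma34_localTowerKerPrimary_cyclicExtension_rat)
    (hper₀ : ∀ [NeZero (c32505h1.conductorNorm ℤ)] (f : CuspForm (Gamma0 (c32505h1.conductorNorm ℤ)) 2),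
      IsNewformOf c32505h1 f → ∀ ϖ : ℚ, (ϖ : ℝ) * c32505h1.realPeriodRat = plusPeriod f →
        0 ≤ padicValRat 2 ϖ)
    (hlow : ∀ κ : ZpExtension ℚ 2, κ.IsCyclotomic →
      2 ^ 2 ≤ Nat.card {z : c32505h1.selmerLayer κ 0 // 2 • z = 0})
    {d : ℕ} (hd : d ≤ 4)
    (hup : ∀ κ : ZpExtension ℚ 2, κ.IsCyclotomic →
      Nat.card {z : c32505h1.selmerLayer κ 3 // 2 • z = 0} ≤ 2 ^ d) :
    MainConjectureLowerDivisibilityAtTwoOrd c32505h1 := by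
  refine katoHalfAt_two_of_layerSelmer_cert_gap c32505h1 h17 h33g hM hA hS34 hper₀ goodOrd_two_32505h1
    not_two_dvd_torsionOrder (j := 0) (j' := 3) (by norm_num) {3, 5, 11, 197} ?_ mem_P_of_dvd
    (fun ℓ ↦ if ℓ = 3 ∨ ℓ = 11 then 2 else 1) (fun _ ↦ 0) (fun ℓ ↦ if ℓ = 5 then 9 else 1) ?_
    (fun ℓ _ hℓ ↦ ?_) hlow hup ?_
  · intro ℓ hℓ
    simp only [Finset.mem_insert, Finset.mem_singleton] at hℓ
    rcases hℓ with rfl | rfl | rfl | rfl <;> exact ⟨by norm_num, by norm_num⟩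
  · intro ℓ hℓ
    simp only [Finset.mem_insert, Finset.mem_singleton] at hℓ
    rcases hℓ with rfl | rfl | rfl | rfl <;> norm_num
  · simp only [Finset.mem_insert, Finset.mem_singleton] at hℓ
    rcases hℓ with rfl | rfl | rfl | rfl
    · exact Or.inr (Or.inl ⟨hasMultiplicativeReductionAtPrime 3 (Or.inl rfl), by norm_num⟩)
    · refine Or.inr (Or.inr (Or.inl ⟨hasMultiplicativeReductionAtPrime 5 (Or.inr (Or.inl rfl)), ?_, ?_,
        by norm_num, by norm_num⟩))
      · rw [minimalDiscriminantInt_eq]; norm_num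
      · rw [minimalDiscriminantInt_eq]; norm_num
    · exact Or.inr (Or.inl ⟨hasMultiplicativeReductionAtPrime 11 (Or.inr (Or.inr (Or.inl rfl))),
        by norm_num⟩)
    · refine Or.inr (Or.inr (Or.inl ⟨hasMultiplicativeReductionAtPrime 197 (Or.inr (Or.inr (Or.inr rfl))),
        ?_, ?_, by norm_num, by norm_num⟩))
      · rw [minimalDiscriminantInt_eq]; norm_num
      · rw [minimalDiscriminantInt_eq]; norm_num
  · calc 2 ^ d * 4 * ∏ ℓ ∈ ({3, 5, 11, 197} : Finset ℕ),
          (if ℓ = 3 ∨ ℓ = 11 then 2 else 1) ^ 2 ^ min 3 ((fun _ : ℕ ↦ 0) ℓ)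
        ≤ 2 ^ 4 * 4 * ∏ ℓ ∈ ({3, 5, 11, 197} : Finset ℕ),
          (if ℓ = 3 ∨ ℓ = 11 then 2 else 1) ^ 2 ^ min 3 ((fun _ : ℕ ↦ 0) ℓ) :=
          Nat.mul_le_mul_right _ (Nat.mul_le_mul_right _ (Nat.pow_le_pow_right (by norm_num) hd))
      _ < 2 ^ (2 ^ 3 - 2 ^ 0 + 2) := by decide

end Summit.BirchSwinnertonDyer.BirchSwinnertonDyer.Theorems.KatoHalfPinch.Tower32505h

end
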